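import Summits.CriticalPhenomena.PercolationContinuityZ3.Theorems.PercNearOneGluingNoHeavyQuantBlockCombRootSlide
import Summits.CriticalPhenomena.PercolationContinuityZ3.Theorems.PercNearOneGluingNoHeavyQuantBlockCombPairWitness
import HarnessLib

/-!
# QUANT lane R8, FAR on trees: every block-comb that is ALL-TIED EXCEPT TWO BLOCKS (canonical model, every depth)

builds on p205010 (kernel theorem, internal audit signed; external expert review pending)

Support file (`--supports stmt-CriticalPhenomena-4575`), QUANT lane seat prim-quant-census-2 (gen 48); memo
`run/shared/lean/prim/quant/prim-quant-census-2-g48/TIED-PLUS-TWO-G48.md` (paper proof + exact instance-wise certificate of every branch, `checkF2.py`,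
10 000 instances / 0 failures).  Theorems only (local notation, no definitions), no sorries, standard axioms.  Model/notation: `…QuantBlockCombMergeModel.lean`;
tools: p1 g8's law-free MERGE step `tail_transfer_le` and `tail_ge_marg_of_giant`, lead g12's `tail_ge_of_class`, lead g13's ROOT SPLIT
`tail_succ_ge_rootGate_mul` / `sum_marg_le_contracted` (`…TwoPlateauRoot`) and the bookkeeping + induction skeleton of the ONE-block theorem
`tail_ge_of_tied_plus_one` (`…TiedPlusRoot`, p246017); this seat's `tail_ge_of_carrier_pair` (`…PairWitness`) and `tail_ge_of_slide_to_tied` (`…RootSlide`).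

* `Quant.BlockComb.tail_ge_of_tied_plus_two` — **THEOREM.**  Chain of `D+1` gates in `[0,1]`; two designated blobs `s₀ ≠ s₁` (any levels, any gates,
  possibly dead; marginal `≥ x` when live); every OTHER live blob TIED at `x = ∏_{i ≤ D} q i > 0`; budget `2j < Σ_k a k·marginal k`.  Then
  `x ≤ TAIL = P(N ≥ j+1)`: EVERY block-comb that is all-tied except TWO blocks satisfies the far-relay row — lead g13's open target (HANDOFF GEN-13 (b);
  LEAD-NOTES-G13 N24 (8) 'Honest scope', (9)).  `tail_ge_of_tied_but_two`: the same with `s₀ = s₁` allowed.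
  PROOF (induction on `#live blobs + D`): a giant ⟹ `tail_ge_marg_of_giant`.  A live tied ROOT blob `τ ∉ {s₀, s₁}`: if `j ≤ x·(n − a τ)` merge it
  (`tail_transfer_le`: family kept, budget not lowered); otherwise `x·n < j(1 + x)` and the budget give `a s₀(m₀ − x) + a s₁(m₁ − x) > j(1 − x)` and
  `tail_ge_of_carrier_pair` closes (PAIR WITNESS `TAIL ≥ W_l·g s₀·g s₁ ≥ m₀m₁ > x`).  No tied root blob outside `{s₀, s₁}`: if some live designated root
  blob is LIGHT (`q 0·g < x`), `tail_ge_of_slide_to_tied` (AFFINE SLIDE: tie the lighter one, then the one-block theorem); else ROOT SPLIT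
  `TAIL[D+1, q] ≥ q 0·TAIL[D, q∘succ, lv−1]` and the induction hypothesis at `x/q 0` (at `D = 0`: the class theorem at `x' = 1`).
Honest scope: three or more non-tied blocks are not covered — with `k ≥ 3` carriers the non-mergeable corner only gives `Σ a_s(m_s − x) > j(1 − x)`,
which forces no product witness (LEAD-NOTES-G13 N24 (4), harmonic staircase); the merge and the slide are `k`-independent, so the general block-comb row
now reduces to that corner.
[this work]
-/

namespace Summit.CriticalPhenomena.PercolationContinuityZ3.Theorems

namespace Quant

namespace BlockComb

open Finset

variable {κ : Type*} [Fintype κ] [DecidableEq κ]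

/-- product-Bernoulli weight of the set `S` of open blob gates -/
local notation3 "wt[" g ", " S "]" => ∏ k, (if k ∈ (S : Finset κ) then (g : κ → ℝ) k else 1 - (g : κ → ℝ) k)

/-- probability that the chain `q` of length `D` is open exactly to depth `i` -/
local notation3 "pd[" D ", " q ", " i "]" =>
  (∏ i' ∈ Finset.range (i : ℕ), (q : ℕ → ℝ) i') * (if (i : ℕ) < (D : ℕ) then 1 - (q : ℕ → ℝ) i else 1)

/-- mass counted at depth `i` in blob configuration `S` -/
local notation3 "mass[" lv ", " a ", " i ", " S "]" =>
  ∑ k ∈ (S : Finset κ).filter (fun k => (lv : κ → ℕ) k ≤ (i : ℕ)), ((a : κ → ℕ) k : ℕ)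

/-- the tail `P(N ≥ j+1)` of the block-comb count, as an explicit finite sum -/
local notation3 "TAIL[" D ", " q ", " lv ", " a ", " g ", " j "]" =>
  ∑ i ∈ Finset.range ((D : ℕ) + 1), pd[D, q, i] *
    ∑ S : Finset κ, wt[g, S] * (if (j : ℕ) + 1 ≤ mass[lv, a, i, S] then (1 : ℝ) else 0)

/-- the root-level crossing probability `Φ₀ = Σ_S wt S·𝟙[j+1 ≤ root mass of S]` (the chain closed at its first gate) -/
local notation3 "ROOT[" lv ", " a ", " g ", " j "]" =>
  ∑ S : Finset κ, wt[g, S] * (if (j : ℕ) + 1 ≤ mass[lv, a, 0, S] then (1 : ℝ) else 0)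

/-! ### The theorem -/

set_option maxHeartbeats 800000 in
/-- The induction behind `tail_ge_of_tied_plus_two` (on `#live blobs + D`). [this work] -/
theorem tail_ge_of_tied_plus_two_aux : ∀ (M : ℕ) (D : ℕ) (q : ℕ → ℝ), (∀ i, 0 ≤ q i ∧ q i ≤ 1) →
    ∀ (lv : κ → ℕ) (a : κ → ℕ) (g : κ → ℝ), (∀ k, 0 ≤ g k ∧ g k ≤ 1) → ∀ (j : ℕ),
    (∀ k, 0 < a k → lv k ≤ D + 1) →
    ∀ (s₀ s₁ : κ), s₀ ≠ s₁ → ∀ (x : ℝ), 0 < x → x = ∏ i ∈ Finset.range (D + 1), q i →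
    (∀ k, 0 < a k → k ≠ s₀ → k ≠ s₁ → (∏ i ∈ Finset.range (lv k), q i) * g k = x) →
    (0 < a s₀ → x ≤ (∏ i ∈ Finset.range (lv s₀), q i) * g s₀) →
    (0 < a s₁ → x ≤ (∏ i ∈ Finset.range (lv s₁), q i) * g s₁) →
    (2 * j : ℝ) < ∑ k, (a k : ℝ) * ((∏ i ∈ Finset.range (lv k), q i) * g k) →
    (Finset.univ.filter (fun k => 0 < a k)).card + D ≤ M →
    x ≤ TAIL[D + 1, q, lv, a, g, j] := by
  intro M
  induction M with
  | zero =>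
    intro D q hq lv a g hg j hlv s₀ s₁ hne x hx0 hxq htied hheavy₀ hheavy₁ hbudget hM
    -- no live blob: the budget `0 > 2j ≥ 0` is absurd
    have hcard : (Finset.univ.filter (fun k => 0 < a k)).card = 0 := by omega
    have hnone : ∀ k, a k = 0 := by
      intro k
      by_contra hk
      have : k ∈ Finset.univ.filter (fun k => 0 < a k) := Finset.mem_filter.2 ⟨Finset.mem_univ _, Nat.pos_of_ne_zero hk⟩
      rw [Finset.card_eq_zero.1 hcard] at this
      exact absurd this (Finset.notMem_empty _)
    have h0 : ∑ k, (a k : ℝ) * ((∏ i ∈ Finset.range (lv k), q i) * g k) = 0 :=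
      Finset.sum_eq_zero fun k _ => by rw [hnone k]; simp
    have : (0 : ℝ) ≤ 2 * j := by positivity
    linarith
  | succ M ih =>
    intro D q hq lv a g hg j hlv s₀ s₁ hne x hx0 hxq htied hheavy₀ hheavy₁ hbudget hM
    -- the marginals of the designated blocks and of every live blob
    set ρ₀ : ℝ := (∏ i ∈ Finset.range (lv s₀), q i) * g s₀ with hρ₀def
    set ρ₁ : ℝ := (∏ i ∈ Finset.range (lv s₁), q i) * g s₁ with hρ₁def
    have hmarg : ∀ k, 0 < a k → x ≤ (∏ i ∈ Finset.range (lv k), q i) * g k := by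
      intro k hk
      by_cases hk0 : k = s₀
      · rw [hk0]; exact hheavy₀ (hk0 ▸ hk)
      · by_cases hk1 : k = s₁
        · rw [hk1]; exact hheavy₁ (hk1 ▸ hk)
        · exact (htied k hk hk0 hk1).ge
    -- (i) a giant blob decides alone
    by_cases hgiant : ∃ k, 0 < a k ∧ j + 1 ≤ a k
    · obtain ⟨k, hk, hkj⟩ := hgiant
      exact (hmarg k hk).trans (tail_ge_marg_of_giant (D + 1) q hq lv a g hg j k hkj (hlv k hk))
    push Not at hgiant
    have hsmall : ∀ k, (a k : ℝ) ≤ j := by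
      intro k
      by_cases hk : 0 < a k
      · exact_mod_cast Nat.lt_succ_iff.1 (hgiant k hk)
      · have : a k = 0 := by omega
        rw [this]; exact_mod_cast Nat.zero_le j
    set n : ℝ := ∑ k, (a k : ℝ) with hn
    -- the budget splits as `x·n + a s₀(ρ₀ − x) + a s₁(ρ₁ − x)`
    have hmean_eq : ∑ k, (a k : ℝ) * ((∏ i ∈ Finset.range (lv k), q i) * g k) =
        x * n + (a s₀ : ℝ) * (ρ₀ - x) + (a s₁ : ℝ) * (ρ₁ - x) := by
      have h1 : ∀ k, (a k : ℝ) * ((∏ i ∈ Finset.range (lv k), q i) * g k) =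
          x * (a k : ℝ) + (a k : ℝ) * ((∏ i ∈ Finset.range (lv k), q i) * g k - x) := fun k => by ring
      rw [Finset.sum_congr rfl fun k _ => h1 k, Finset.sum_add_distrib, ← Finset.mul_sum, ← hn]
      have h2 : ∑ k, (a k : ℝ) * ((∏ i ∈ Finset.range (lv k), q i) * g k - x) =
          ∑ k ∈ ({s₀, s₁} : Finset κ), (a k : ℝ) * ((∏ i ∈ Finset.range (lv k), q i) * g k - x) := by
        symm
        refine Finset.sum_subset (Finset.subset_univ _) fun k _ hk => ?_
        simp only [Finset.mem_insert, Finset.mem_singleton, not_or] at hk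
        by_cases hak : 0 < a k
        · rw [htied k hak hk.1 hk.2, sub_self, mul_zero]
        · have : a k = 0 := by omega
          rw [this]; simp
      rw [h2, Finset.sum_pair hne, ← hρ₀def, ← hρ₁def]
      ring
    -- (ii) a live tied ROOT blob outside `{s₀, s₁}`
    by_cases htroot : ∃ τ, 0 < a τ ∧ τ ≠ s₀ ∧ τ ≠ s₁ ∧ lv τ = 0
    · obtain ⟨τ, hτ, hτ0, hτ1, hτlv⟩ := htroot
      have hgτ : g τ = x := by
        have := htied τ hτ hτ0 hτ1; rwa [hτlv, Finset.prod_range_zero, one_mul] at this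
      have hjpos : 0 < j := by
        by_contra hj
        have : j = 0 := by omega
        have := hgiant τ hτ
        omega
      set a₀ := Function.update a τ 0 with ha₀
      have ha₀τ : a₀ τ = 0 := by rw [ha₀, Function.update_self]
      have ha₀ne : ∀ k, k ≠ τ → a₀ k = a k := fun k hk => by rw [ha₀, Function.update_of_ne hk]
      have hsum₀ : ∑ k, ((a₀ k : ℕ) : ℝ) = n - a τ := by
        have h := sum_update_univ (fun k => (a k : ℝ)) τ ((0 : ℕ) : ℝ)
        have h' : ∀ k, ((a₀ k : ℕ) : ℝ) = Function.update (fun k => (a k : ℝ)) τ ((0 : ℕ) : ℝ) k := by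
          intro k
          by_cases hk : k = τ
          · subst hk; simp [ha₀τ]
          · rw [ha₀ne k hk, Function.update_of_ne hk]
        rw [Finset.sum_congr rfl fun k _ => h' k, h, hn]
        push_cast; ring
      by_cases hmerge : (j : ℝ) ≤ g τ * ∑ k, ((a₀ k : ℕ) : ℝ)
      · -- (ii-a) merge `τ` into some other live blob: the family is kept and the budget does not drop
        have hpos : ∃ k, 0 < a₀ k := by
          by_contra hnone
          push Not at hnone
          have hzero : ∑ k, ((a₀ k : ℕ) : ℝ) = 0 := by
            refine Finset.sum_eq_zero fun k _ => ?_
            have h0 : a₀ k = 0 := by have := hnone k; omega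
            rw [h0]; simp
          rw [hzero, mul_zero] at hmerge
          have : (0 : ℝ) < j := by exact_mod_cast hjpos
          linarith
        obtain ⟨ℓ, hℓ, hle⟩ := tail_transfer_le (D + 1) q hq lv a g hg j τ hτlv hmerge hpos
        have hℓτ : ℓ ≠ τ := by
          rintro rfl
          rw [Function.update_self] at hℓ
          exact lt_irrefl _ hℓ
        have haℓ : 0 < a ℓ := by
          have h := hℓ
          rwa [Function.update_of_ne hℓτ] at h
        set aT := Function.update a₀ ℓ (a₀ ℓ + a τ) with haT
        have haTτ : aT τ = 0 := by rw [haT, Function.update_of_ne hℓτ.symm, ha₀τ]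
        have haTℓ : aT ℓ = a ℓ + a τ := by rw [haT, Function.update_self, ha₀ne ℓ hℓτ]
        have haTne : ∀ k, k ≠ τ → k ≠ ℓ → aT k = a k := fun k hkτ hkℓ => by
          rw [haT, Function.update_of_ne hkℓ, ha₀ne k hkτ]
        have hlive : ∀ k, 0 < aT k → 0 < a k ∧ k ≠ τ := by
          intro k hk
          have hkτ : k ≠ τ := fun h => by rw [h, haTτ] at hk; exact lt_irrefl _ hk
          refine ⟨?_, hkτ⟩
          by_cases hkℓ : k = ℓ
          · rw [hkℓ]; exact haℓ
          · rw [← haTne k hkτ hkℓ]; exact hk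
        have hlive' : ∀ k, 0 < a k → k ≠ τ → 0 < aT k := by
          intro k hk hkτ
          by_cases hkℓ : k = ℓ
          · rw [hkℓ, haTℓ]; omega
          · rw [haTne k hkτ hkℓ]; exact hk
        have hlvT : ∀ k, 0 < aT k → lv k ≤ D + 1 := fun k hk => hlv k (hlive k hk).1
        have htiedT : ∀ k, 0 < aT k → k ≠ s₀ → k ≠ s₁ → (∏ i ∈ Finset.range (lv k), q i) * g k = x :=
          fun k hk hk0 hk1 => htied k (hlive k hk).1 hk0 hk1
        have hheavy₀T : 0 < aT s₀ → x ≤ (∏ i ∈ Finset.range (lv s₀), q i) * g s₀ :=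
          fun h => hheavy₀ (hlive s₀ h).1
        have hheavy₁T : 0 < aT s₁ → x ≤ (∏ i ∈ Finset.range (lv s₁), q i) * g s₁ :=
          fun h => hheavy₁ (hlive s₁ h).1
        have hbudgetT : (2 * j : ℝ) < ∑ k, (aT k : ℝ) * ((∏ i ∈ Finset.range (lv k), q i) * g k) := by
          have h := sum_cast_mul_transfer a (fun k => (∏ i ∈ Finset.range (lv k), q i) * g k) τ ℓ hℓτ
          rw [haT, ha₀, h]
          have hmτ : (∏ i ∈ Finset.range (lv τ), q i) * g τ = x := htied τ hτ hτ0 hτ1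
          have hmℓ : x ≤ (∏ i ∈ Finset.range (lv ℓ), q i) * g ℓ := hmarg ℓ haℓ
          have h5 : (0 : ℝ) ≤ a τ := Nat.cast_nonneg _
          nlinarith [mul_le_mul_of_nonneg_left hmℓ h5]
        have hcardT : (Finset.univ.filter (fun k => 0 < aT k)).card + 1 =
            (Finset.univ.filter (fun k => 0 < a k)).card := by
          rw [haT, ha₀]; exact card_live_transfer a τ ℓ hℓτ hτ haℓ
        have hMT : (Finset.univ.filter (fun k => 0 < aT k)).card + D ≤ M := by omega
        exact (ih D q hq lv aT g hg j hlvT s₀ s₁ hne x hx0 hxq htiedT hheavy₀T hheavy₁T hbudgetT hMT).trans hle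
      · -- (ii-b) `τ` cannot merge: the two designated blocks carry `> j(1 − x)`, and the pair witness closes
        push Not at hmerge
        rw [hgτ, hsum₀] at hmerge
        have hbud : (2 * j : ℝ) < x * n + (a s₀ : ℝ) * (ρ₀ - x) + (a s₁ : ℝ) * (ρ₁ - x) := by
          rw [← hmean_eq]; exact hbudget
        have haτj : (a τ : ℝ) ≤ j := hsmall τ
        have hxaτ : x * (a τ : ℝ) ≤ x * j := mul_le_mul_of_nonneg_left haτj hx0.le
        have hmerge' : x * n - x * (a τ : ℝ) < j := by rw [← mul_sub]; exact hmerge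
        have hkey : (j : ℝ) * (1 - x) < (a s₀ : ℝ) * (ρ₀ - x) + (a s₁ : ℝ) * (ρ₁ - x) := by nlinarith
        have hx1 : x ≤ 1 := by have := hgτ ▸ (hg τ).2; linarith
        exact tail_ge_of_carrier_pair (D + 1) q hq lv a g hg j hlv s₀ s₁ hne x hx0 hx1 hjpos hsmall
          (fun h => hheavy₀ h) (fun h => hheavy₁ h) hkey
    -- (iii) no live tied root blob outside `{s₀, s₁}`
    push Not at htroot
    have hrootonly : ∀ k, 0 < a k → lv k = 0 → k = s₀ ∨ k = s₁ := by
      intro k hk hk0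
      by_contra h
      push Not at h
      exact htroot k hk h.1 h.2 hk0
    have hne' : ∃ k, 0 < a k := by
      by_contra hnone
      push Not at hnone
      have h0 : ∑ k, (a k : ℝ) * ((∏ i ∈ Finset.range (lv k), q i) * g k) = 0 := by
        refine Finset.sum_eq_zero fun k _ => ?_
        have hk : a k = 0 := by have := hnone k; omega
        rw [hk]; simp
      have : (0 : ℝ) ≤ 2 * j := by positivity
      linarith
    have hq0 : 0 < q 0 := by
      rcases (hq 0).1.lt_or_eq with h | h
      · exact h
      · exfalso; rw [hxq, prefixProd_succ, ← h, zero_mul] at hx0; exact lt_irrefl _ hx0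
    -- the affine slide, packaged for a designated pair `(r, s)` = `(s₀, s₁)` or `(s₁, s₀)`
    have hslide : ∀ r s, (r = s₀ ∧ s = s₁) ∨ (r = s₁ ∧ s = s₀) → 0 < a r → lv r = 0 → q 0 * g r < x →
        (0 < a s → lv s = 0 → g r ≤ g s) → x ≤ TAIL[D + 1, q, lv, a, g, j] := by
      intro r s hrs hr hr0 hrx hs'
      have hxr : x ≤ g r := by
        have := hmarg r hr; rwa [hr0, Finset.prod_range_zero, one_mul] at this
      refine tail_ge_of_slide_to_tied D q hq lv a g hg j hlv r s x hx0 hxq ?_ ?_ hr hr0 hxr hrx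
        (fun hs => hmarg s hs) hs' hbudget
      · intro k hk hkr hks
        rcases hrs with ⟨rfl, rfl⟩ | ⟨rfl, rfl⟩
        · exact htied k hk hkr hks
        · exact htied k hk hks hkr
      · intro k hk hk0
        rcases hrs with ⟨rfl, rfl⟩ | ⟨rfl, rfl⟩
        · exact hrootonly k hk hk0
        · exact (hrootonly k hk hk0).symm
    -- (iii-a) a live designated ROOT blob lighter than the deep private gates: slide (tie the lighter one)
    by_cases hL₀ : 0 < a s₀ ∧ lv s₀ = 0 ∧ q 0 * g s₀ < x
    · by_cases hL₁ : 0 < a s₁ ∧ lv s₁ = 0 ∧ q 0 * g s₁ < x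
      · rcases le_total (g s₀) (g s₁) with h | h
        · exact hslide s₀ s₁ (Or.inl ⟨rfl, rfl⟩) hL₀.1 hL₀.2.1 hL₀.2.2 (fun _ _ => h)
        · exact hslide s₁ s₀ (Or.inr ⟨rfl, rfl⟩) hL₁.1 hL₁.2.1 hL₁.2.2 (fun _ _ => h)
      · refine hslide s₀ s₁ (Or.inl ⟨rfl, rfl⟩) hL₀.1 hL₀.2.1 hL₀.2.2 (fun hs hs0 => ?_)
        have hge : x ≤ q 0 * g s₁ := by
          by_contra hlt; push Not at hlt; exact hL₁ ⟨hs, hs0, hlt⟩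
        exact (lt_of_mul_lt_mul_left (hL₀.2.2.trans_le hge) (hq 0).1).le
    · by_cases hL₁ : 0 < a s₁ ∧ lv s₁ = 0 ∧ q 0 * g s₁ < x
      · refine hslide s₁ s₀ (Or.inr ⟨rfl, rfl⟩) hL₁.1 hL₁.2.1 hL₁.2.2 (fun hs hs0 => ?_)
        have hge : x ≤ q 0 * g s₀ := by
          by_contra hlt; push Not at hlt; exact hL₀ ⟨hs, hs0, hlt⟩
        exact (lt_of_mul_lt_mul_left (hL₁.2.2.trans_le hge) (hq 0).1).le
      -- (iii-b) every live root blob (necessarily designated) has `q 0·g ≥ x`: contract the first gate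
      have hheavyroot : ∀ k, 0 < a k → lv k = 0 → x ≤ q 0 * g k := by
        intro k hk hk0
        by_contra hlt
        push Not at hlt
        rcases hrootonly k hk hk0 with rfl | rfl
        · exact hL₀ ⟨hk, hk0, hlt⟩
        · exact hL₁ ⟨hk, hk0, hlt⟩
      -- root split + induction hypothesis (or the class theorem at `D = 0`) for the contracted instance
      have hsplit := tail_succ_ge_rootGate_mul D q hq lv a g hg j
      cases D with
      | zero =>
        -- `x = q 0`; in the contracted instance every live gate is `1`
        have hx1 : x = q 0 := by rw [hxq, Finset.prod_range_one]
        have hgate1 : ∀ k, 0 < a k → (1 : ℝ) ≤ (∏ i ∈ Finset.range (lv k - 1), q (i + 1)) * g k := by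
          intro k hk
          have hlk : lv k ≤ 1 := hlv k hk
          have hpre : ∏ i ∈ Finset.range (lv k - 1), q (i + 1) = 1 := by
            have : lv k - 1 = 0 := by omega
            rw [this, Finset.prod_range_zero]
          rw [hpre, one_mul]
          by_cases hk0 : lv k = 0
          · have h := hheavyroot k hk hk0
            rw [hx1] at h
            have h' : q 0 * 1 ≤ q 0 * g k := by rw [mul_one]; exact h
            exact le_of_mul_le_mul_left h' hq0
          · have hk1 : lv k = 1 := by omega
            have h := hmarg k hk
            rw [hk1, Finset.prod_range_one, hx1] at h
            have h' : q 0 * 1 ≤ q 0 * g k := by rw [mul_one]; exact h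
            exact le_of_mul_le_mul_left h' hq0
        have hclass : (2 * j : ℝ) < (∑ k', (a k' : ℝ)) * 1 := by
          rw [mul_one]
          refine hbudget.trans_le (Finset.sum_le_sum fun k _ => ?_)
          have h1 : (∏ i ∈ Finset.range (lv k), q i) * g k ≤ 1 :=
            mul_le_one₀ (prefixProd_mem q hq _).2 (hg k).1 (hg k).2
          calc (a k : ℝ) * ((∏ i ∈ Finset.range (lv k), q i) * g k) ≤ (a k : ℝ) * 1 :=
              mul_le_mul_of_nonneg_left h1 (Nat.cast_nonneg _)
            _ = (a k : ℝ) := mul_one _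
        have hlv' : ∀ k, 0 < a k → lv k - 1 ≤ 0 := fun k hk => by have := hlv k hk; omega
        have h := tail_ge_of_class 0 (fun i => q (i + 1)) (fun i => hq (i + 1)) (fun k => lv k - 1) a g hg j hlv' 1
          hgate1 hclass hne'
        calc x = q 0 * 1 := by rw [hx1, mul_one]
          _ ≤ q 0 * TAIL[0, (fun i => q (i + 1)), (fun k => lv k - 1), a, g, j] := mul_le_mul_of_nonneg_left h (hq 0).1
          _ ≤ TAIL[0 + 1, q, lv, a, g, j] := hsplit
      | succ D' =>
        have hx' : x / q 0 = ∏ i ∈ Finset.range (D' + 1), q (i + 1) := by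
          rw [div_eq_iff hq0.ne', hxq, prefixProd_succ, mul_comm]
        have hmarg' : ∀ k, lv k ≠ 0 →
            (∏ i ∈ Finset.range (lv k - 1), q (i + 1)) * g k = ((∏ i ∈ Finset.range (lv k), q i) * g k) / q 0 := by
          intro k hk0
          obtain ⟨m, hm⟩ := Nat.exists_eq_succ_of_ne_zero hk0
          rw [hm, Nat.succ_sub_one, prefixProd_succ, eq_div_iff hq0.ne']
          ring
        have htied' : ∀ k, 0 < a k → k ≠ s₀ → k ≠ s₁ →
            (∏ i ∈ Finset.range (lv k - 1), q (i + 1)) * g k = x / q 0 := by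
          intro k hk hk0 hk1
          have hlk : lv k ≠ 0 := by
            intro h
            rcases hrootonly k hk h with h' | h'
            · exact hk0 h'
            · exact hk1 h'
          rw [hmarg' k hlk, htied k hk hk0 hk1]
        have hheavy' : ∀ k, 0 < a k → x / q 0 ≤ (∏ i ∈ Finset.range (lv k - 1), q (i + 1)) * g k := by
          intro k hk
          by_cases hk0 : lv k = 0
          · rw [hk0, Nat.zero_sub, Finset.prod_range_zero, one_mul, div_le_iff₀ hq0, mul_comm]
            exact hheavyroot k hk hk0
          · rw [hmarg' k hk0]
            exact div_le_div_of_nonneg_right (hmarg k hk) hq0.le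
        have hlv' : ∀ k, 0 < a k → lv k - 1 ≤ D' + 1 := fun k hk => by have := hlv k hk; omega
        have hbudget' : (2 * j : ℝ) < ∑ k, (a k : ℝ) * ((∏ i ∈ Finset.range (lv k - 1), q (i + 1)) * g k) :=
          hbudget.trans_le (sum_marg_le_contracted q hq lv a g hg)
        have hM' : (Finset.univ.filter (fun k => 0 < a k)).card + D' ≤ M := by omega
        have h := ih D' (fun i => q (i + 1)) (fun i => hq (i + 1)) (fun k => lv k - 1) a g hg j hlv' s₀ s₁ hne
          (x / q 0) (div_pos hx0 hq0) hx' htied' (fun hk => hheavy' s₀ hk) (fun hk => hheavy' s₁ hk) hbudget' hM'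
        calc x = q 0 * (x / q 0) := by field_simp
          _ ≤ q 0 * TAIL[D' + 1, (fun i => q (i + 1)), (fun k => lv k - 1), a, g, j] := mul_le_mul_of_nonneg_left h (hq 0).1
          _ ≤ TAIL[D' + 1 + 1, q, lv, a, g, j] := hsplit

/-- **THEOREM (FAR for every block-comb that is all-tied except two blocks, canonical model, every depth).**  Chain gates and private
gates in `[0,1]`; live levels `≤ D+1`; two designated blobs `s₀ ≠ s₁` (any levels, any gates, possibly dead) whose marginals are `≥ x` when
they are live; every other live blob with marginal exactly `x = ∏_{i ≤ D} q i > 0`; `2j < Σ_k a k·marginal k`.  Conclusion: `x ≤ P(N ≥ j+1)`.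
[this work] -/
theorem tail_ge_of_tied_plus_two (D : ℕ) (q : ℕ → ℝ) (hq : ∀ i, 0 ≤ q i ∧ q i ≤ 1) (lv : κ → ℕ) (a : κ → ℕ)
    (g : κ → ℝ) (hg : ∀ k, 0 ≤ g k ∧ g k ≤ 1) (j : ℕ) (hlv : ∀ k, 0 < a k → lv k ≤ D + 1)
    (s₀ s₁ : κ) (hne : s₀ ≠ s₁) (x : ℝ) (hx0 : 0 < x) (hxq : x = ∏ i ∈ Finset.range (D + 1), q i)
    (htied : ∀ k, 0 < a k → k ≠ s₀ → k ≠ s₁ → (∏ i ∈ Finset.range (lv k), q i) * g k = x)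
    (hheavy₀ : 0 < a s₀ → x ≤ (∏ i ∈ Finset.range (lv s₀), q i) * g s₀)
    (hheavy₁ : 0 < a s₁ → x ≤ (∏ i ∈ Finset.range (lv s₁), q i) * g s₁)
    (hbudget : (2 * j : ℝ) < ∑ k, (a k : ℝ) * ((∏ i ∈ Finset.range (lv k), q i) * g k)) :
    x ≤ TAIL[D + 1, q, lv, a, g, j] :=
  tail_ge_of_tied_plus_two_aux _ D q hq lv a g hg j hlv s₀ s₁ hne x hx0 hxq htied hheavy₀ hheavy₁ hbudget le_rfl

/-- **COROLLARY (at most two non-tied blocks, the designated pair not necessarily distinct).**  With `s₀ = s₁` allowed this is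
`tail_ge_of_tied_plus_one` (one block) or `tail_ge_of_tied_plus_two`. [this work] -/
theorem tail_ge_of_tied_but_two (D : ℕ) (q : ℕ → ℝ) (hq : ∀ i, 0 ≤ q i ∧ q i ≤ 1) (lv : κ → ℕ) (a : κ → ℕ)
    (g : κ → ℝ) (hg : ∀ k, 0 ≤ g k ∧ g k ≤ 1) (j : ℕ) (hlv : ∀ k, 0 < a k → lv k ≤ D + 1)
    (s₀ s₁ : κ) (x : ℝ) (hx0 : 0 < x) (hxq : x = ∏ i ∈ Finset.range (D + 1), q i)
    (htied : ∀ k, 0 < a k → k ≠ s₀ → k ≠ s₁ → (∏ i ∈ Finset.range (lv k), q i) * g k = x)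
    (hheavy₀ : x ≤ (∏ i ∈ Finset.range (lv s₀), q i) * g s₀)
    (hheavy₁ : x ≤ (∏ i ∈ Finset.range (lv s₁), q i) * g s₁)
    (hbudget : (2 * j : ℝ) < ∑ k, (a k : ℝ) * ((∏ i ∈ Finset.range (lv k), q i) * g k)) :
    x ≤ TAIL[D + 1, q, lv, a, g, j] := by
  by_cases hne : s₀ = s₁
  · subst hne
    exact tail_ge_of_tied_plus_one D q hq lv a g hg j hlv s₀ x hx0 hxq (fun k hk hks => htied k hk hks hks) hheavy₀ hbudget
  · exact tail_ge_of_tied_plus_two D q hq lv a g hg j hlv s₀ s₁ hne x hx0 hxq htied (fun _ => hheavy₀) (fun _ => hheavy₁) hbudget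

end BlockComb

end Quant

end Summit.CriticalPhenomena.PercolationContinuityZ3.Theorems
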